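import Summits.Ventures.PercRepro.SixFourResidueFourPlaneLineInventory

/-!
# PercRepro — C-025 at `(6,4)`: the plane-line branch (γ) at `t = 4`, part 2A — the shape of a set counted by `X`
on a plane-line solid (p5, gen 10; lead (nn))

Lemma X̄′ (mine-2's §21.18.4 (a) / §22.12.3) bounds the partner count `X = #{Z ⊆ G : r(Z) ≤ 3, r(G ∖ Z) ≤ 3}` of a
plane-line solid WITHOUT any plane cap.  This file collects the matroid facts the count needs, for a normalisation
`D : PLData M G` with `|L| ≥ 2`:

* a set with two points of `L` spans the line `ℓ` (`ellF_subset_clF_of_two_mem`); if its rank is `≤ 2` it lies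
  in `ℓ` (`subset_ellF_of_two_mem_of_eRk_le_two`); if its rank is `3` its closure is the plane of a class and it
  lies in `L ∪ C` (`exists_class_of_two_mem_of_eRk_eq_three`, from `plane_trichotomy`);
* a set containing a point of `L` and a rank-`3` part of `ρ` has rank `4` (`eRk_eq_four_of_mem_L`);
* the trace of a class on the line spanned by its complement has at most one point (`card_lamC_le_one`), and a
  rank-`≤ 2` set between `ρ ∖ C` and `ρ` lies on that line (`subset_clF_sdiff_of_eRk_le_two`);
* two distinct classes covering `ρ` are the only two classes (`classes_eq_of_cover`).
-/

namespace PercRepro.SixFour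

open Finset ThmH

variable {α : Type*} [DecidableEq α] {M : Matroid α} [M.Finite] {G : Finset α}

namespace PLData

variable {D : PLData M G}

omit [DecidableEq α] in
/-- Membership in `clF` is membership in the closure. -/
theorem mem_closure_of_mem_clF {B : Finset α} {z : α} (h : z ∈ clF M B) : z ∈ M.closure (B : Set α) := by
  have := Finset.mem_coe.2 h
  rwa [coe_clF] at this

/-- `ℓ` has rank `2`. -/
theorem eRk_ellF (hs : Simple M) (hG : G ⊆ gr M) (h2 : 2 ≤ D.L.card) :
    M.eRk ((D.ellF : Finset α) : Set α) = 2 :=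
  (mem_lines.1 (D.ellF_mem_lines hs hG h2).1).2.2

/-- `ℓ` is a flat: its closure is itself. -/
theorem closure_ellF (hs : Simple M) (hG : G ⊆ gr M) (h2 : 2 ≤ D.L.card) :
    M.closure ((D.ellF : Finset α) : Set α) = (D.ellF : Set α) := by
  have hfl := (mem_lines.1 (D.ellF_mem_lines hs hG h2).1).2.1
  exact hfl.closure

/-- **Two points of `L` span `ℓ`**: `ℓ ⊆ cl(Z)` for every `Z ⊆ G` with two points of `L`. -/
theorem ellF_subset_clF_of_two_mem (hs : Simple M) (hG : G ⊆ gr M) {Z : Finset α}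
    (h2 : 2 ≤ (Z ∩ D.L).card) : D.ellF ⊆ clF M Z := by
  obtain ⟨a, ha, b, hb, hab⟩ := Finset.one_lt_card.1 h2
  rw [Finset.mem_inter] at ha hb
  have hL2 : 2 ≤ D.L.card := by
    have := Finset.card_le_card (Finset.inter_subset_right : Z ∩ D.L ⊆ D.L)
    omega
  have hpair := closure_pair_eq_of_eRk_le_two hs (D.L_subset.trans hG) D.rank_rest ha.2 hb.2 hab
  have hsub : (({a, b} : Finset α) : Set α) ⊆ (Z : Set α) := by
    intro z hz
    rw [Finset.coe_insert, Finset.coe_singleton, Set.mem_insert_iff, Set.mem_singleton_iff] at hz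
    rcases hz with rfl | rfl
    · exact ha.1
    · exact hb.1
  rw [← Finset.coe_subset, coe_clF]
  unfold ellF
  rw [coe_clF, ← hpair]
  exact M.closure_subset_closure hsub

/-- **A rank-`≤ 2` set with two points of `L` lies in `ℓ`.** -/
theorem subset_ellF_of_two_mem_of_eRk_le_two (hs : Simple M) (hG : G ⊆ gr M) {Z : Finset α}
    (hZ : Z ⊆ G) (h2 : 2 ≤ (Z ∩ D.L).card) (hr : M.eRk (Z : Set α) ≤ 2) : Z ⊆ D.ellF := by
  have hL2 : 2 ≤ D.L.card := by
    have := Finset.card_le_card (Finset.inter_subset_right : Z ∩ D.L ⊆ D.L)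
    omega
  have hℓ := ellF_subset_clF_of_two_mem hs hG h2
  -- `cl(Z)` is a flat of rank `≤ 2` containing the rank-`2` flat `ℓ`: they coincide
  have heq : M.closure ((D.ellF : Finset α) : Set α) = M.closure (Z : Set α) := by
    refine closure_eq_of_subset_flat (M.isFlat_closure _) ?_ (Finset.finite_toSet _) ?_
    · have := Finset.coe_subset.2 hℓ
      rwa [coe_clF] at this
    · rw [M.eRk_closure_eq, eRk_ellF hs hG hL2]
      exact hr
  rw [closure_ellF hs hG hL2] at heq
  have hZcl : (Z : Set α) ⊆ M.closure (Z : Set α) :=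
    M.subset_closure _ (by rw [← coe_gr]; exact_mod_cast hZ.trans hG)
  rw [← heq] at hZcl
  exact_mod_cast hZcl

/-- **A rank-`3` set with two points of `L` lies in the trace `L ∪ C` of the plane of a class.** -/
theorem exists_class_of_two_mem_of_eRk_eq_three (hs : Simple M) (hG : G ⊆ gr M) {Z : Finset α}
    (hZ : Z ⊆ G) (h2 : 2 ≤ (Z ∩ D.L).card) (hr : M.eRk (Z : Set α) = 3) :
    ∃ C ∈ D.classes, Z ⊆ D.L ∪ C := by
  have hL2 : 2 ≤ D.L.card := by
    have := Finset.card_le_card (Finset.inter_subset_right : Z ∩ D.L ⊆ D.L)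
    omega
  obtain ⟨hP, hZP⟩ := clF_mem_planes (hZ.trans hG) hr
  set P := clF M Z with hPdef
  have hZPG : Z ⊆ P ∩ G := Finset.subset_inter hZP hZ
  have hr3 : M.eRk ((P ∩ G : Finset α) : Set α) = 3 := by
    apply le_antisymm (eRk_inter_plane_le_three hP G)
    have := M.eRk_mono (Finset.coe_subset.2 hZPG)
    rwa [hr] at this
  rcases plane_trichotomy hs hG hL2 hP hr3 with h0 | ⟨y, hy, hPy⟩ | ⟨x, -, hPx, -, -⟩
  · -- `Z ⊆ P₀` contradicts a point of `L`
    exfalso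
    obtain ⟨a, ha⟩ := Finset.card_pos.1 (by omega : 0 < (Z ∩ D.L).card)
    rw [Finset.mem_inter] at ha
    have haP : a ∈ D.P₀ := by rw [← h0]; exact hZP ha.1
    unfold L at ha
    exact (Finset.mem_sdiff.1 ha.2).2 haP
  · rw [Finset.mem_sdiff] at hy
    refine ⟨D.lam y, Finset.mem_image_of_mem _ (Finset.mem_sdiff.2 hy), ?_⟩
    have := D.Pi_inter_G_eq hs hG hL2 y
    rw [← hPy] at this
    rw [← this]
    exact hZPG
  · -- the trace has one point of `L`, but `Z` has two
    exfalso
    have hsub : Z ∩ D.L ⊆ {x} := by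
      intro z hz
      rw [Finset.mem_inter] at hz
      have hzP : z ∈ P ∩ G := hZPG hz.1
      rw [hPx, Finset.mem_insert] at hzP
      rcases hzP with rfl | hzρ
      · exact Finset.mem_singleton_self _
      · exfalso
        have hzρ' : z ∈ D.ρ := (Finset.mem_inter.1 hzρ).2
        unfold L at hz
        unfold ρ at hzρ'
        exact (Finset.mem_sdiff.1 hz.2).2 (Finset.mem_inter.1 hzρ').1
    have := Finset.card_le_card hsub
    rw [Finset.card_singleton] at this
    omega

/-- **A point of `L` over a rank-`3` part of `ρ` gives rank `4`**: no set of rank `≤ 3` contains a point of `L`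
and a rank-`3` subset of `ρ`. -/
theorem eRk_eq_four_of_mem_L (hG : G ⊆ gr M) {S W : Finset α} (hW : W ⊆ D.ρ) (hWS : W ⊆ S) (hS : S ⊆ G)
    (hr : M.eRk (W : Set α) = 3) {x : α} (hx : x ∈ D.L) (hxS : x ∈ S) : 4 ≤ M.eRk (S : Set α) := by
  have hWP : W ⊆ D.P₀ := fun z hz => (Finset.mem_inter.1 (hW hz)).1
  have hcl : M.closure (W : Set α) = (D.P₀ : Set α) := closure_eq_of_subset_plane D.plane hWP hr
  have hxE : x ∈ M.E := by rw [← coe_gr]; exact_mod_cast hG (hS hxS)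
  have hxcl : x ∉ M.closure (W : Set α) := by
    rw [hcl]
    unfold L at hx
    exact fun h => (Finset.mem_sdiff.1 hx).2 (Finset.mem_coe.1 h)
  have hins : M.eRk ((insert x W : Finset α) : Set α) = 4 := by
    rw [Finset.coe_insert, M.eRk_insert_eq_add_one ⟨hxE, hxcl⟩, hr]
    rfl
  have hsub : insert x W ⊆ S := Finset.insert_subset hxS hWS
  rw [← hins]
  exact M.eRk_mono (Finset.coe_subset.2 hsub)

/-- A class of a solid with plane traces `≤ g − 3` misses at least three points of `ρ`. -/
theorem three_le_card_sdiff_class (hs : Simple M) (hG : G ⊆ gr M) (h2 : 2 ≤ D.L.card)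
    (hpl : ∀ P ∈ planes M, (P ∩ G).card + 3 ≤ G.card) {C : Finset α} (hC : C ∈ D.classes) :
    3 ≤ (D.ρ \ C).card := by
  have hplane := (PiC_facts hs hG h2 hC).1
  have h := hpl _ hplane
  rw [card_PiC_inter_G hs hG h2 hC] at h
  have hsum := D.card_ρ_add_card_L
  have hCρ : C ⊆ D.ρ := (classes_facts hC hs hG h2).1
  have := Finset.card_sdiff_add_card_eq_card hCρ
  omega

/-- A flat of rank `2` containing two points of `C` is `cl` of those two points; two distinct points of the
line `cl(ρ ∖ C)` cannot both lie in `C`. -/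
theorem card_lamC_le_one (hs : Simple M) (hG : G ⊆ gr M) (h2 : 2 ≤ D.L.card)
    (hpl : ∀ P ∈ planes M, (P ∩ G).card + 3 ≤ G.card) {C : Finset α} (hC : C ∈ D.classes)
    (hr : M.eRk ((D.ρ \ C : Finset α) : Set α) ≤ 2) : (C ∩ clF M (D.ρ \ C)).card ≤ 1 := by
  by_contra hlt
  push Not at hlt
  obtain ⟨c₁, hc₁, c₂, hc₂, hne⟩ := Finset.one_lt_card.1 hlt
  rw [Finset.mem_inter] at hc₁ hc₂
  have hρG : D.ρ \ C ⊆ gr M := Finset.sdiff_subset.trans (D.ρ_subset.trans hG)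
  have h3 := three_le_card_sdiff_class hs hG h2 hpl hC
  -- `ρ ∖ C` has rank exactly `2`
  have hr2 : M.eRk ((D.ρ \ C : Finset α) : Set α) = 2 := by
    apply le_antisymm hr
    obtain ⟨a, ha, b, hb, hab⟩ := Finset.one_lt_card.1 (by omega : 1 < (D.ρ \ C).card)
    exact two_le_eRk_of_two_mem hs hρG ha hb hab
  -- the line `λ = cl(ρ ∖ C)` is `cl{c₁, c₂}`
  have hlam : M.closure (({c₁, c₂} : Finset α) : Set α) = M.closure ((D.ρ \ C : Finset α) : Set α) := by
    refine closure_eq_of_subset_flat (M.isFlat_closure _) ?_ (Finset.finite_toSet _) ?_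
    · intro z hz
      rw [Finset.coe_insert, Finset.coe_singleton, Set.mem_insert_iff, Set.mem_singleton_iff] at hz
      rcases hz with rfl | rfl
      · exact mem_closure_of_mem_clF hc₁.2
      · exact mem_closure_of_mem_clF hc₂.2
    · rw [M.eRk_closure_eq, hr2]
      have hCG : C ⊆ gr M := (classes_facts hC hs hG h2).1.trans (D.ρ_subset.trans hG)
      exact two_le_eRk_of_two_mem hs (by
        intro z hz
        rw [Finset.mem_insert, Finset.mem_singleton] at hz
        rcases hz with rfl | rfl
        · exact hCG hc₁.1
        · exact hCG hc₂.1) (Finset.mem_insert_self _ _)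
        (Finset.mem_insert_of_mem (Finset.mem_singleton_self _)) hne
  -- `{c₁, c₂} ⊆ Π_C ∩ P₀`, a flat, so `λ ⊆ Π_C ∩ P₀` and `ρ ∖ C ⊆ λ ∩ G ⊆ Π_C ∩ ρ = C`: absurd
  have hPiC := PiC_facts hs hG h2 hC
  have hPiflat := (mem_planes.1 hPiC.1).2.1
  have hP₀flat := (mem_planes.1 D.plane).2.1
  have hCρ : C ⊆ D.ρ := (classes_facts hC hs hG h2).1
  have key : ∀ c ∈ C, c ∈ (D.PiC C : Set α) ∧ c ∈ (D.P₀ : Set α) := fun c hc =>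
    ⟨Finset.mem_coe.2 (hPiC.2.2 (Finset.mem_union_right _ hc)),
      Finset.mem_coe.2 (Finset.mem_inter.1 (hCρ hc)).1⟩
  have hsub1 : (({c₁, c₂} : Finset α) : Set α) ⊆ (D.PiC C : Set α) := by
    intro z hz
    rw [Finset.coe_insert, Finset.coe_singleton, Set.mem_insert_iff, Set.mem_singleton_iff] at hz
    rcases hz with rfl | rfl
    · exact (key _ hc₁.1).1
    · exact (key _ hc₂.1).1
  have hsub2 : (({c₁, c₂} : Finset α) : Set α) ⊆ (D.P₀ : Set α) := by
    intro z hz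
    rw [Finset.coe_insert, Finset.coe_singleton, Set.mem_insert_iff, Set.mem_singleton_iff] at hz
    rcases hz with rfl | rfl
    · exact (key _ hc₁.1).2
    · exact (key _ hc₂.1).2
  have hlamsub1 : M.closure (({c₁, c₂} : Finset α) : Set α) ⊆ (D.PiC C : Set α) := by
    have := M.closure_subset_closure hsub1
    rwa [hPiflat.closure] at this
  have hlamsub2 : M.closure (({c₁, c₂} : Finset α) : Set α) ⊆ (D.P₀ : Set α) := by
    have := M.closure_subset_closure hsub2
    rwa [hP₀flat.closure] at this
  obtain ⟨w, hw⟩ := Finset.card_pos.1 (by omega : 0 < (D.ρ \ C).card)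
  have hwlam : (w : α) ∈ M.closure ((D.ρ \ C : Finset α) : Set α) :=
    M.subset_closure _ (by rw [← coe_gr]; exact_mod_cast hρG) (Finset.mem_coe.2 hw)
  rw [← hlam] at hwlam
  have hwC : w ∈ C := by
    have hw' := hlamsub1 hwlam
    have hwρ : w ∈ D.ρ := (Finset.mem_sdiff.1 hw).1
    have : w ∈ D.PiC C ∩ D.ρ := Finset.mem_inter.2 ⟨Finset.mem_coe.1 hw', hwρ⟩
    rwa [PiC_inter_ρ hs hG h2 hC] at this
  exact (Finset.mem_sdiff.1 hw).2 hwC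

/-- **A rank-`≤ 2` set between `ρ ∖ C` and `ρ` lies on the line `cl(ρ ∖ C)`, which then has rank `≤ 2`.** -/
theorem subset_clF_sdiff_of_eRk_le_two (hs : Simple M) (hG : G ⊆ gr M) (h2 : 2 ≤ D.L.card)
    (hpl : ∀ P ∈ planes M, (P ∩ G).card + 3 ≤ G.card) {C : Finset α} (hC : C ∈ D.classes) {W : Finset α}
    (hWρ : W ⊆ D.ρ) (hCW : D.ρ \ C ⊆ W) (hr : M.eRk (W : Set α) ≤ 2) :
    M.eRk ((D.ρ \ C : Finset α) : Set α) ≤ 2 ∧ W ⊆ clF M (D.ρ \ C) := by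
  have hmono := M.eRk_mono (Finset.coe_subset.2 hCW)
  refine ⟨hmono.trans hr, ?_⟩
  have hρG : D.ρ \ C ⊆ gr M := Finset.sdiff_subset.trans (D.ρ_subset.trans hG)
  have h3 := three_le_card_sdiff_class hs hG h2 hpl hC
  have hr2 : (2 : ℕ∞) ≤ M.eRk ((D.ρ \ C : Finset α) : Set α) := by
    obtain ⟨a, ha, b, hb, hab⟩ := Finset.one_lt_card.1 (by omega : 1 < (D.ρ \ C).card)
    exact two_le_eRk_of_two_mem hs hρG ha hb hab
  have heq : M.closure ((D.ρ \ C : Finset α) : Set α) = M.closure (W : Set α) := by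
    refine closure_eq_of_subset_flat (M.isFlat_closure _) ?_ (Finset.finite_toSet _) ?_
    · exact (Finset.coe_subset.2 hCW).trans (M.subset_closure _ (by rw [← coe_gr]; exact_mod_cast hWρ.trans (D.ρ_subset.trans hG)))
    · rw [M.eRk_closure_eq]
      exact hr.trans hr2
  have hWcl : (W : Set α) ⊆ M.closure (W : Set α) :=
    M.subset_closure _ (by rw [← coe_gr]; exact_mod_cast hWρ.trans (D.ρ_subset.trans hG))
  rw [← heq, ← coe_clF] at hWcl
  exact_mod_cast hWcl

/-- **Two distinct classes covering `ρ` are the only classes.** -/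
theorem classes_eq_of_cover (hs : Simple M) (hG : G ⊆ gr M) (h2 : 2 ≤ D.L.card) {A B : Finset α}
    (hA : A ∈ D.classes) (hB : B ∈ D.classes) (hcov : D.ρ ⊆ A ∪ B) {K : Finset α}
    (hK : K ∈ D.classes) : K = A ∨ K = B := by
  obtain ⟨-, y, hyK, hyℓ⟩ := classes_facts hK hs hG h2
  have hyρ : y ∈ D.ρ := (classes_facts hK hs hG h2).1 hyK
  have hpd := classes_pairwiseDisjoint (D := D) hs hG h2
  rcases Finset.mem_union.1 (hcov hyρ) with hyA | hyB
  · left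
    by_contra hne
    have hdisj := hpd (Finset.mem_coe.2 hK) (Finset.mem_coe.2 hA) hne
    rw [Function.onFun, Finset.disjoint_left] at hdisj
    exact hdisj (Finset.mem_sdiff.2 ⟨hyK, hyℓ⟩) (Finset.mem_sdiff.2 ⟨hyA, hyℓ⟩)
  · right
    by_contra hne
    have hdisj := hpd (Finset.mem_coe.2 hK) (Finset.mem_coe.2 hB) hne
    rw [Function.onFun, Finset.disjoint_left] at hdisj
    exact hdisj (Finset.mem_sdiff.2 ⟨hyK, hyℓ⟩) (Finset.mem_sdiff.2 ⟨hyB, hyℓ⟩)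

/-- The classes are nonempty (a point of `ρ` outside `ℓ` has a class). -/
theorem classes_nonempty (hs : Simple M) (hG : G ⊆ gr M) (h2 : 2 ≤ D.L.card) : D.classes.Nonempty := by
  obtain ⟨y, hy⟩ := D.ρ_sdiff_ellF_nonempty hs hG h2
  exact ⟨D.lam y, Finset.mem_image_of_mem _ hy⟩

/-- `ℓ ∩ ρ` lies in every class. -/
theorem ellF_inter_ρ_subset_class {C : Finset α} (hC : C ∈ D.classes) : D.ellF ∩ D.ρ ⊆ C := by
  obtain ⟨y, -, -, rfl⟩ := exists_eq_lam hC
  intro z hz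
  rw [Finset.mem_inter] at hz
  exact mem_lam_of_mem_ellF hz.1 hz.2

/-- `ℓ ∩ ρ` has at most one point. -/
theorem card_ellF_inter_ρ_le_one (hs : Simple M) (hG : G ⊆ gr M) (h2 : 2 ≤ D.L.card) :
    (D.ellF ∩ D.ρ).card ≤ 1 := by
  have := D.card_ellF_inter_le_one hs hG h2
  refine le_trans (Finset.card_le_card ?_) this
  intro z hz
  rw [Finset.mem_inter] at hz ⊢
  exact ⟨hz.1, (Finset.mem_inter.1 hz.2).1⟩

end PLData

end PercRepro.SixFour
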